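import Mathlib
import HarnessLib
import HarnessLib.Audit
import Summits.QuantumFields.Statement

/-!
Route: MarginalTwistOnset

DORMANT since 2026-09-03T05:48:31Z (reconciler: no traction for 5 d (last activity statement-checked at 2026-08-29T04:51:00Z); parked, not closed — `ledger route dormant route-QuantumFields-MarginalTwistOnset --off` to reactivate) — unstaffed, not closed; items shared with open routes are served there. `ledger route dormant <id> --off` reactivates.

# Route MarginalTwistOnset — vortex condensation at the marginal scale — 't Hooft twist deficits
vanish below exp(Cβ) for all large β, DGLT-style

It suffices to show X := ExpScaleTwistOnset ∧ SingleScaleFluxCriterion ∧ LargeBetaFluxGap, together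
with the shared Osterwalder–Schrader
legs PinnedFluxGapToYangMills and CentrelessWeakCouplingYangMills (owned by other cards, shared
verbatim with route FluxBootstrap, filed as
support so the glue typechecks) and the femto-universe support FixedTorusCriterionFailure that pins
the flux scale (repair 2026-08-16 at
the statement re-type p116790: `YangMills` gained the weak-coupling conjunct
`sch.HasWeakCouplingLimit`, β_k = 2/g₀² → ∞, which the
glue PROVES from β_k = k through the legs' subsequence clause; the unpinned FluxGapToYangMills and
the pre-revision CentrelessYangMills
are superseded). Card realised:
marginal-disorder-relevance-transplant (spine). With Z_{β,S}(z;q) Wilson's partition function of the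
faithful representation r of the
compact simple group G on the symmetric torus (ℤ/S)⁴ carrying 't Hooft's twist z ∈ Z(G) on the
(q)-stack, and δ := 1 − Z(z;q)/Z(1;q) the
twist deficit (e^{−F_mg}): (B = ExpScaleTwistOnset, the card's K1 deliverable) for EVERY compact
simple G and faithful r there are C > 0
and scales S₀(β) → ∞ with S₀(β) ≤ e^{Cβ} such that max_{z,q} δ_{β,S₀(β)} → 0 as β → ∞ — 't Hooft's
criterion is met, for all large β,
no later than an asymptotic-scaling-shaped scale (the marginal scale ξ^{1+ε} of the dictionary); (K3
= SingleScaleFluxCriterion, shared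
with route FluxBootstrap) an ε-deficit at one scale propagates to Gaussian decay; (LargeBetaFluxGap)
at weak coupling the flux scale
bounds the clustering rate of all gauge-invariant local observables. The signature prediction
SharpTwistTransmutation (one rate κ_r:
twist ratio ≤ η below e^{(1−ε)κβ}, deficit ≤ η above e^{(1+ε)κβ}) is filed as a further crux; it
implies B (support SharpImpliesOnset).
Lean: `ExpScaleTwistOnset ∧ FixedTorusCriterionFailure ∧ SingleScaleFluxCriterion ∧ LargeBetaFluxGap
∧ PinnedFluxGapToYangMills ∧ CentrelessWeakCouplingYangMills`

## Assembly
Pure logic plus instance and `Nat.find` bookkeeping, PROVED sorry-free as `closes` in the planner's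
Sketch.lean (= glue.lean; axioms
propext / Classical.choice / Quot.sound; re-certified 2026-08-16 against the re-typed `YangMills`):
fix G; if Z(G) = ⊥ use
CentrelessWeakCouplingYangMills; otherwise take a faithful r from IsCompactSimpleLieGroup (T2 /
second countability of G from the closed
embedding r.ρ), instantiate the twisted partition function by its defining integral, obtain (ε, c,
C') from SingleScaleFluxCriterion and
(m, β₁) from LargeBetaFluxGap; along β_k := k let S₀(k) be the LEAST torus size ≥ 2 at which the
min(ε,½)-criterion holds — it exists
for large k by ExpScaleTwistOnset, it diverges by FixedTorusCriterionFailure (at every fixed size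
the criterion eventually fails), and
by minimality the criterion fails at the comparable size S₀(k) − 1: the flux scale is pinned. The
criterion at S₀(k) gives Gaussian
twist decay for all S ≥ S₀(k), LargeBetaFluxGap (eventually β_k ≥ β₁) gives clustering at rate
m/S₀(k) on all tori 2S+1, S ≥ S₀(k),
and PinnedFluxGapToYangMills, fed the same r, the pin and the clustering, returns a scheme whose
couplings are a subsequence β ∘ φ of
β_k = k — hence sch.HasWeakCouplingLimit — with the OS data, non-triviality, non-Gaussianity and
both gaps. SharpTwistTransmutation
enters only through SharpImpliesOnset (alternative entry to the same chain); the bound S₀(β) ≤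
e^{Cβ} of ExpScaleTwistOnset is the
line's content but is not consumed by the glue.

Rationale: WHY THIS LINE. Of the rigorous engines that have ever produced a dynamically generated scale
exp(−c/coupling^p) flat to all orders (the shape
Literature.Barriers.QuantumFields.PerturbativeInvisibility certifies for the gap), only marginal
disorder relevance
(DerridaEtAl2009, GiacominToninelliLacoin2009, Lacoin2009; BergerLacoin2017 Thm 1.1: lim β² log Δf =
−π for the 1+2 directed polymer)
is infinite-dimensional and small-parameter-free at the scale where the effect lives; its
architecture is (M1) an O(1)-entropy change of
measure at the marginal scale N*^{1+ε}, (M2) transfer by fractional moments / the entropy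
inequality, (M3) coarse-graining of a
threshold crossed at ONE scale. The card's dictionary (two-replica overlap log ↔ b₀ log, Landau pole
↔ β̂ = 1, N ↔ L², p(β) ↔ −σ,
Z_N ↔ the electric-flux Boltzmann factor e^{−L·E_e(L)}) lands on 't Hooft's twisted partition
functions (Thooft1979; TomboulisYaffe1985;
KovacsTomboulis2000: Z₋/Z₊ → 1 at ≈ 1.25 fm), the one family of UV-finite, RP-gluable, exactly
spectral lattice quantities. Working the
transplant through (planner's analysis, NOTES.md): any "∃ bounded-entropy tilt" statement is
LOGICALLY EQUIVALENT to the onset statement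
it serves (Gibbs variational principle / conditioning on the typical event), so (M1)–(M2) are
method, not items, and the honest crux is
the deliverable itself — B: the twist deficit is small by the marginal scale e^{Cβ} for ALL large β
— with (M3) = the shared flux
criterion and the two transfer inequalities filed as provable-now support. What the line does that
others do not: route FluxBootstrap
anchors the same criterion along SOME sequence β_k by a finite-physical-volume continuum limit plus
one certified number; Tomboulis2007
(arXiv:0707.2179, gap found by ItoSeiler2007) tried all β by Migdal–Kadanoff decimation (barrier
MigdalKadanoffGroupBlindness); here the
anchor is analytic, for every large β, pinned at the asymptotic-scaling scale, with an intrinsic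
sharp two-sided rate
(SharpTwistTransmutation, the Berger–Lacoin shape) as the falsifiable signature. Imported:
disordered systems / polymer measures
(change of measure, fractional moments, relative entropy), finite-size criteria (statistical
mechanics), 't Hooft flux algebra.

RANKED CRUXES. #2 ExpScaleTwistOnset (crux) — card K1's deliverable (the missing entry made a
statement). For every compact simple Lie G and EVERY faithful unitary lattice representation r there
are C > 0 and a scale function S₀ : ℝ → ℕ with S₀(β) → ∞ and, eventually in β, S₀(β) ≤ e^{Cβ}, such
that for every ε > 0, eventually in β, the twist deficit 1 − Z_{β,S₀(β)}(z;q)/Z_{β,S₀(β)}(1;q) is ≤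
ε for every central z and plane q ('t Hooft's criterion met for all large β no later than an
exponential = asymptotic-scaling-shaped scale; twisted partition function inline via ∀ Z, hZ → …, as
in route FluxBootstrap). To be proved DGLT-style: an O(1)-entropy change of measure at S₀(β) =
ξ^{1+ε} fed by one-loop (second-moment) control below ξ^{1−ε}, transferred by EntropyEventTransfer /
FractionalMomentTransfer. [difficulty: open-problem] (why it might fail: It IS 't Hooft's criterion
at weak coupling for all large β; the DGLT tilt has no formal second level here (any
bounded-entropy-tilt statement is equivalent to B), so B may be as hard as confinement; a
weak-coupling deconfined phase or sub-exponential onset for one simple G refutes it.) [Thooft1979,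
KovacsTomboulis2000, Tomboulis2007, ItoSeiler2007, BergerLacoin2017, Lacoin2009, DerridaEtAl2009,
Greensite2011Confinement]
#3 SingleScaleFluxCriterion (crux) — (M3) of the architecture = card K3 in criterion form; SHARED
verbatim with route FluxBootstrap (its rank-2 crux; the gate dedups and attaches this route). For
every compact metrisable G and continuous unitary ρ there are ε, c, C > 0, uniform in β ≥ 0 and the
scale, such that max_{z,q} deficit ≤ ε at ONE torus size S₀ ≥ 2 forces |deficit| ≤ C e^{−c S²/S₀²}
for all S ≥ S₀. [difficulty: open-problem] (why it might fail: No gluing is known: RP/chessboard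
bounds a doubled twist only through OPEN vortex sheets with perimeter losses (TomboulisYaffe1985);
twist free energies are not known super-additive; one re-entrant deficit family (≤ ε at S₀, O(1) at
S ≫ S₀) kills it.) [Thooft1979, TomboulisYaffe1985, MackPetkova1980, Greensite2011Confinement,
KovacsTomboulis2000]
#4 LargeBetaFluxGap (crux) — confinement scale ⇒ gap at weak coupling, in the shape the glue needs
and AUDITED against vacuity (planner's variant of FluxBootstrap.FluxScaleControlsGap, which is
refutable: for centreless G its hypothesis is vacuous and it asserts β-uniform clustering). For
every compact simple Lie G with Z(G) ≠ 1, every faithful r and all c, C > 0 there are m > 0 and β₁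
such that for all gauge-invariant local A, B there is K with: for every β ≥ β₁ and S₀ ≥ 2, if
|deficit_{β,S}(z;q)| ≤ C e^{−cS²/S₀²} for all S ≥ S₀, central z and planes q, then |⟨A;τ_n
B⟩_{β,(2S+1)⁴}| ≤ K e^{−m n/S₀} for all S ≥ S₀, n ≤ S (exactly the latticeConnectedCorr of
HasLatticeMassGap). [deps: SingleScaleFluxCriterion] [difficulty: open-problem] (why it might fail:
σ>0 ⇏ gap: no inequality m ≥ c√σ is known for any (G,r); twist ratios are blind to centre-neutral
light states (a 0⁺⁺ softening near a critical endpoint met at large β by an exotic reducible r); β ≥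
β₁ only removes bulk transitions bounded in β.) [TomboulisYaffe1985, ForcrandSmekal2002,
BhanotCreutz1981, OsterwalderSeilerAnnPhys1978, Greensite2011Confinement]
#5 SharpTwistTransmutation (crux) — the signature prediction of the transplant (Berger–Lacoin's lim
β² log Δf = −π in twist language, with an INTRINSIC rate instead of b₀): for every compact simple
Lie G and faithful r there is ONE κ > 0 such that for all ε, η > 0, eventually in β: (suppression,
the femto/Bałaban window) Z_{β,S}(z;q)/Z_{β,S}(1;q) ≤ η for every central z ≠ 1, every plane and all
2 ≤ S ≤ e^{(1−ε)κβ}; (onset) 1 − Z_{β,S}(z;q)/Z_{β,S}(1;q) ≤ η for every central z, plane and all S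
≥ e^{(1+ε)κβ}. Expected κ_r = 12π²/(11N) for SU(N) fundamental in the tree's action normalisation
(24π²T_r/(11h^∨) in general); implies ExpScaleTwistOnset (support SharpImpliesOnset, proved in
Sketch.lean) and ExpScaleTwistSuppression. [deps: ExpScaleTwistOnset] [difficulty: open-problem]
(why it might fail: Asserts ONE exponential rate for the end of the femto regime and the onset of
confinement; power-law (two-loop, Λ-ratio) corrections are absorbed by ε, but an intermediate window
of width e^{δβ} where the twist ratio plateaus at an O(1) value (as U(1)'s ϑ-constant does at all
scales) refutes it.) [Luscher1983, GonzalezarroyoAltes1988, DanielGonzalezarroyoKorthalsaltes1990,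
ForcrandSmekal2002, BergerLacoin2017, Thooft1979]
#9 ExpScaleTwistSuppression (support) — the perturbative half of the dictionary (weak disorder below
N*^{1−ε} ↔ femto universe below ξ^{1−ε}), where Bałaban's small-field technology should reach: for
every compact simple Lie G and faithful r there is c > 0 such that for every η > 0, eventually in β,
Z_{β,S}(z;q)/Z_{β,S}(1;q) ≤ η for every central z ≠ 1, every plane and all 2 ≤ S ≤ e^{cβ}
(twist-eating flat connections have fewer moduli than periodic ones; the twisted sector is
suppressed by a power of the running coupling throughout the window). With ExpScaleTwistOnset it
brackets the onset scale between two exponentials. [difficulty: XL] [Luscher1983,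
GonzalezarroyoAltes1988, DanielGonzalezarroyoKorthalsaltes1990, Balaban1989LargeFieldII]
#9 SharpImpliesOnset (support) — pure logic + Nat.ceil bookkeeping (proved sorry-free in the
planner's Sketch.lean, theorem sharpImpliesOnset_holds): the sharp two-sided statement gives
ExpScaleTwistOnset with C = 3κ and S₀(β) = ⌈e^{2κβ}⌉. [difficulty: provable-now] [BergerLacoin2017]
#9 EntropyEventTransfer (support) — (M2, entropy form) the change-of-measure inequality of the
disorder-relevance method over Mathlib's `InformationTheory.klDiv`: for probability measures μ, ν
with H(ν|μ) = klDiv ν μ < ∞ and an event A with ν(A) > 0, μ(A) ≥ ν(A)·exp(−(H(ν|μ) + e⁻¹)/ν(A))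
(Jensen on A and Aᶜ plus x log x ≥ −e⁻¹). [difficulty: provable-now] [GiacominToninelliLacoin2009,
DerridaEtAl2009, Lacoin2009]
#9 FractionalMomentTransfer (support) — (M2, fractional-moment form) Hölder transfer of a fractional
moment to a tilted first moment: for probability measures μ ≪ ν, measurable f ≥ 0 and θ ∈ (0,1), ∫
f^θ dμ ≤ (∫ f dν)^θ (∫ (dμ/dν)^{1/(1−θ)} dν)^{1−θ} (lintegrals; `ENNReal.lintegral_mul_le_Lp_mul_Lq`
with p = 1/θ, q = 1/(1−θ) after ∫ f^θ dμ = ∫ f^θ (dμ/dν) dν). [difficulty: provable-now]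
[DerridaEtAl2009, Lacoin2009, BergerLacoin2017]
#9 FixedTorusCriterionFailure (crux, rank 9 — binder of `closes`; filed at the repair of 2026-08-16
as the weakest femto-side pin of the flux scale) — 't Hooft's criterion FAILS in the femto universe
(β → ∞ on a FIXED lattice): for every compact simple Lie G with Z(G) ≠ 1, faithful r, torus size S ≥
2 and ε < 1, eventually in β some twist deficit exceeds ε (min_{z,q} Z(z;q)/Z(1;q) → 0 by
finite-dimensional Laplace asymptotics: only the periodic sector carries the trivial connection's
4·dim G quartic toron modes — a z-twisted flat connection has its zero modes in the proper
centraliser of a pair with commutator z; SU(N) with z a generator is Morse–Bott). Implied by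
ExpScaleTwistSuppression. [difficulty: L] (why it might fail: SINGULAR flat-connection strata — a
twisted stratum whose toron exponent ties the periodic one for every z ≠ 1 gives min_z Z(z)/Z(1) ↛
0.) [Thooft1979, Luscher1983, GonzalezarroyoAltes1988, KollerVanbaal1986, ForcrandSmekal2002]
#9 PinnedFluxGapToYangMills (crux, rank 9 — binder of `closes`) — the OS LEGS fed by the flux side
WITH a two-sided pin — NOT this route's claim; SHARED verbatim with route FluxBootstrap
(stmt-QuantumFields-10477; cards os-legs-fine-print, torus-clause-is-thermal-v2,
parabolic-renormalised-trajectory); supersedes the unpinned FluxGapToYangMills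
(stmt-QuantumFields-8953: S₀(k) not tied to β_k, met by oversized scales — rreview-0815T13-6/14-6
OBJ. 2). For compact simple Lie G with Z(G) ≠ 1, faithful r, ε ∈ (0,1), m > 0, β_k ≥ 0 with β_k → ∞
and S₀(k) → ∞: if eventually the ε-criterion holds at S₀(k) AND fails at some S' with S₀(k) ≤ 2S',
and all gauge-invariant local A, B cluster at rate m/S₀(k) uniformly on the tori (2S+1)⁴, S ≥ S₀(k),
then ∃ sch, T with sch.β = β ∘ φ (φ strictly increasing — whence sch.HasWeakCouplingLimit), L_k ≥
S₀(φ k), IsYangMillsFor r sch T, non-trivial non-Gaussian curvature and both gaps. [difficulty: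
open-problem] (why it might fail: carries the whole continuum limit — joint convergence of ALL
species along one subsequence, E1 and non-Gaussianity of tr F² at ℓ* are each open for Wilson's
action.) [JaffeWitten2000, OsterwalderSeilerAnnPhys1978, Balaban1989LargeFieldII, Seiler1982,
ChatterjeeYMProb2019]
#9 CentrelessWeakCouplingYangMills (crux, rank 9 — binder of `closes`) — the REVISED YangMills
clause (first conjunct sch.HasWeakCouplingLimit) for compact simple Lie G with TRIVIAL centre
(adjoint forms, G₂, F₄, E₈), where twists are void — NOT this route's claim; SHARED verbatim with
route FluxBootstrap (stmt-QuantumFields-15941; card adjoint-forms-flux-uniform-quantifier: covering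
reduction); supersedes the pre-revision CentrelessYangMills (stmt-QuantumFields-8954), from which
the weak-coupling conjunct cannot be manufactured. [difficulty: open-problem] (why it might fail: it
IS the summit clause for the centreless groups; G₂/F₄/E₈ have no twist sectors, descent from the
cover for adjoint forms is unproved.) [JaffeWitten2000, Greensite2011Confinement, HollandEtAl2003,
ForcrandJahn2002]

TWO-LAYER PLAN. Foreseen glued splits (nothing filed now; k ≤ 3, depth 1). ExpScaleTwistOnset ⇐
OneLoopTwistResponse (card K2, the quantitative
marginality input: for S ≤ e^{(1−ε)κβ} the second-order response kernel of log Z(z)/Z(1) to the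
plaquette couplings {β_p} is
Hilbert–Schmidt-bounded uniformly in S while its pairing with the uniform direction resums to the
running coupling — twisted-sector
lattice perturbation theory à la Bałaban/Lüscher, to be typed by a grounder) → MarginalTiltOnset
(given that control, an explicit
covariance-type change of measure of O(1) relative entropy on the torus of side e^{(1+ε)κβ} plus
EntropyEventTransfer /
FractionalMomentTransfer yields deficit ≤ ε) → ExpScaleTwistOnset. LargeBetaFluxGap ⇐
AreaLawFromTwistDecay (Tomboulis–Yaffe
W(C) ≤ (e^{−F_el})^{A/S²} on the same torus, Greensite (4.46): provable-now-ish) →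
GapFromAreaLawLargeBeta (the open half) →
LargeBetaFluxGap. SharpTwistTransmutation ⇐ ExpScaleTwistSuppression (Bałaban window, sharp rate) →
sharp onset half →
SharpTwistTransmutation. SingleScaleFluxCriterion: as planned by route FluxBootstrap (TwistGluing →
GluingIteration). FixedTorusCriterionFailure: none foreseen (one finite-dimensional Laplace
estimate; provers attach the Morse–Bott / toron lemmas with `--supports`).

KILL CRITERIA. ¬ExpScaleTwistOnset for one compact simple G with Z(G) ≠ 1 and one faithful r (a
weak-coupling deconfined phase, or onset slower
than every exponential) closes the route (`close --reason refuted:ExpScaleTwistOnset`) — and with it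
every asymptotic-freedom-driven
confinement mechanism on the ledger. ¬SharpTwistTransmutation alone (an intermediate plateau window)
⇒ drop that crux (`--drop`, it is
off the deciding chain) and record that the marginality row of the dictionary is wrong.
¬SingleScaleFluxCriterion (shared with
FluxBootstrap; a re-entrant deficit family) ⇒ pivot: restate ExpScaleTwistOnset in Tomboulis–Yaffe
asymptotic form (Gaussian deficit
decay for all S ≥ S₀(β)), absorbing the criterion. ¬LargeBetaFluxGap (σ > 0 but no gap at weak
coupling for some exotic r) ⇒ restate
for the fundamental / isotypic r. ¬FixedTorusCriterionFailure (a finite torus on which, for some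
faithful r, every twisted
sector stays O(1) relative to the periodic one as β → ∞) ⇒ re-certify `closes` with
ExpScaleTwistSuppression in its place. A proof of FluxBootstrap.ContinuumFluxAnchor does NOT moot
this route (B is the all-β, pinned
statement); a proof of the HasLatticeMassGap clause for all G by any route moots LargeBetaFluxGap.
The shared legs never kill it.

NOT DECOMPOSED YET. The change of measure itself (by the variational-equivalence analysis it is a
METHOD for B, not an item; its computable form waits for
OneLoopTwistResponse); the constants C, κ, (ε, c, C'), (m, β₁); the running coupling / b₀ for
general (G, r) (SharpTwistTransmutation
is deliberately intrinsic: one κ, no Dynkin index in Lean); twisted-sector lattice perturbation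
theory with observables (Bałaban with
flux); the Tomboulis–Yaffe inequality and the transfer-matrix facts 0 < Z(z) ≤ Z(1), z ↦ z⁻¹,
stack-independence (lemmas provers
attach with `--supports`); multi-plane (electric-flux-weight) twists; everything inside
PinnedFluxGapToYangMills and
CentrelessWeakCouplingYangMills (continuum limit, OS axioms, non-triviality, the covering reduction
for adjoint forms).

CHEAPEST FALSIFIER. Vacuity / U(1) audit of each implication item (done by hand, 2026-08-15): with a
trivial centre the twist hypothesis is void, which
makes FluxBootstrap.FluxScaleControlsGap assert β-uniform clustering for e.g. SO(3) (refutable once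
ξ(β) → ∞ lands, cf. route
EquipartitionCriticality) — hence LargeBetaFluxGap carries Z(G) ≠ ⊥, faithful r, β ≥ β₁; and U(1)₄'s
Coulomb phase (twist ratio a
ϑ-constant in (0,1) at ALL scales, Thooft1979 §XI) kills any WEAK-threshold criterion ("ratio ≥ η at
one scale ⇒ decay"), which is why
the O(1)-entropy tilt must be placed at ξ^{1+ε} where the deficit is already exp(−ξ^{2ε})-small and
no weak-threshold item is filed.
Next cheapest (by hand): 2-d YM on the torus, where Z(z) is explicit (Migdal character sum) —
deficits are Gaussian in the side,
matching the criterion's shape; and the femto end of FixedTorusCriterionFailure for SU(2), S = 2,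
one twisted plane: the twisted flat
connections are the isolated quaternion pairs (h⁰ = h¹ = 0) while the periodic ones form the
4-dimensional toron torus, so
Z₋/Z₊ → 0 as a power of β (consistent). Next (kit, uncertified MC, hours): SU(2) Z₋/Z₊ on S = 4…12
at β_std = 2.3…2.7 (ForcrandSmekal2002-type
data): fit S_onset(β) ∝ e^{κβ}; a plateau of the ratio at an O(1) value over a growing window would
kill SharpTwistTransmutation.

NUMBERS. Z₋/Z₊ (SU(2), symmetric L⁴) reaches 1 within errors at L ≈ 1.25 fm (KovacsTomboulis2000;
Greensite2011Confinement §4.4, Fig. 4.3,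
eqs (4.44)–(4.47): e^{−F_mg} = Z₋/Z₊, e^{−F_el} = 1 − e^{−F_mg}, W(C) ≤ (e^{−F_el})^{A/(L_xL_y)},
criterion F_mg ~ L_zL_t e^{−ρL_xL_y}).
Femto regime: electric-flux splittings O(g^{2/3}/L) (Luscher1983; twisted boxes
GonzalezarroyoAltes1988,
DanielGonzalezarroyoKorthalsaltes1990) ⇒ deficit → 1 at fixed S as β → ∞. One loop: a Λ_L =
e^{−1/(2b₀g²)}(b₀g²)^{−b₁/(2b₀²)},
b₀ = 11N/(48π²) (tree `Literature.AQFT.afCoefficient`); in the tree's action normalisation β·Σ(N −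
Re tr U_p) this is ξ/a ∝ e^{κβ}·β^{O(1)}
with κ = 12π²/(11N) for SU(N) fundamental (≈ 5.38 for SU(2), i.e. 3π²/11 ≈ 2.69 per unit of the
standard β = 4/g²). Engine side:
DP in 1+2 has Δf(β) = exp(−(π+o(1))/β²) (BergerLacoin2017 Thm 1.1), earlier −e^{−1/(cβ²)} ≤ p ≤
−e^{−c/β⁴} (Lacoin2009 Thm 1.6);
marginal scale N* = e^{π/β²}, tilt at N*^{1+ε} with O(1) relative entropy. Items at open: 11 (4
cruxes, 6 support, 1 assembly);
after the repair of 2026-08-16 (p116790; crux-only `closes`): 12 (7 cruxes = the 6 binders of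
`closes` + SharpTwistTransmutation, 4 support, 1 assembly).

DEFINITION REQUESTS. None new. `twistedPartitionFunction` (topic
Literature/MathematicalPhysics/QuantumFieldTheory) is already requested by route
FluxBootstrap with exactly the inline `hZ` formula used here; on landing, the five Z-bearing items
of this route are restated by
`set-signature` together with theirs (definitionally equal). Relative entropy is Mathlib's
`InformationTheory.klDiv`; Radon–Nikodym
derivatives `MeasureTheory.Measure.rnDeriv` — no request. Cone facts (route-repair 2026-08-15,
rrepair g2): the dispatcher's import-cone guardrail counts 5 unproved named facts under this route;
all of them sit in the mandatory import chain of Summits.QuantumFields.YangMills.Statement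
(YangMillsOS → YangMillsEuclidean / ContinuumLimitLGT → LatticeGaugeDLR, GaugeGroups →
ConstructiveQFTWave0), none is used by any item or by `closes` (gate cone `#h21_route_deps`: 84
project constants, 0 unproved Literature facts — the only closed unproved Props are this route's 11
items and the target `YangMills`), and the route has no imports of its own: 0 imports droppable, 0
cruxes restated. needs-fact:
Literature.MathematicalPhysics.QuantumLattice.not_isSimpleCompactGroup_unitaryGroup (provable-now,
size S — the scalar circle U(1)·1 ⊂ U(n) is a closed connected central subgroup, ≠ ⊥ since it
contains −1, ≠ ⊤ for card n ≥ 2 by a non-scalar diagonal unitary; for card n = 1, U(1) is abelian;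
not used by this route, marked so the one dischargeable blocker gets a tier-0 seat). NOT debt (open
problems tagged `[status: open]`, CONVENTIONS §4 — to be excluded from the cone census, never proved
as facts): Literature.MathematicalPhysics.QuantumFieldTheory.ClayYangMillsEuclidean,
ClayYangMillsEuclideanGap, ClayYangMillsEuclideanAlong (they reach the cone only through `import
…YangMillsEuclidean` in YangMillsOS.lean, which uses none of that file's declarations — the operator
may drop the import), CaoParkSheffieldProblem (S29; its file ConstructiveQFTWave0 carries the
lattice vocabulary GaugeConfig / plaquetteHolonomy / haarProbability the items use, so it stays).
Settled: Literature.MathematicalPhysics.QuantumLattice.isSpecification_ymSpecification is refuted as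
stated (not_isSpecification_ymSpecification_indiscrete) and its T2 repair
isSpecification_ymSpecification_t2_holds is proved — the census should read it as closed, not
unproved.

Novelty: Searches (2026-08-15): `lit search --hybrid "vortex free energy twisted boundary conditions weak
coupling one-loop twist eaters SU(N)"`
(12 docs: Greensite2011Confinement pp. 45–47 read, Rebbi reprint volume pp. 548–580, Makeenko 2023
pp. 270–276); `lit search --hybrid
"twisted boundary conditions perturbation theory electric flux energies small volume Yang-Mills
torus"` (10, same cluster); `lit search
--source crossref "'t Hooft loop electric flux free energy perturbation theory twisted box
Gonzalez-Arroyo Korthals Altes"` (8: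
GonzalezarroyoAltes1988, DanielGonzalezarroyoKorthalsaltes1990, Giovannangeli–Korthals Altes hot-QCD
't Hooft loops); `--source crossref
"Tomboulis confinement for all values of the coupling four-dimensional SU(2) gauge theory"` (8:
Tomboulis PRL 50 (1983), Kovács–Tomboulis
1997; the 2007 preprint and its rebuttal confirmed as arXiv:0707.2179 / arXiv:0711.4930 via `lit
cite`); `--source crossref "relative
entropy change of measure lattice gauge theory confinement"` (8, none relevant: entanglement-entropy
proceedings only); `--source crossref
"asymptotic scaling string tension rigorous lower bound lattice gauge theory weak coupling"` (8,
numerics/strong-coupling series only);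
`lit galaxy search "vortex free energy asymptotic scaling confinement" | "magnetic flux free energy"
| "twist free energy" | "fractional
moment" --star all` (0 / 0 / 5 irrelevant / 16 irrelevant); `lit frontier QuantumFields --since
2020` (30 rows; nearest arXiv:2605.16162
SO(3) de  [refs: 10.1016/0550-3213(79, 10.1214/15-aihp721, 0707.2179, 0711.4930, 2605.16162, 2605.02156, doi:10.1016/0550-3213, doi:10.1214/15-aihp721, GonzalezarroyoAltes1988, DanielGonzalezarroyoKorthalsaltes1990, Tomboulis2007, ItoSeiler2007, Thooft1979, BergerLacoin2017, Lacoin2009, DerridaEtAl2009]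

Barriers (technique_class: entropy-tilt-fractional-moment, thooft-twist, flux-criterion): - technique_class: entropy-tilt-fractional-moment, thooft-twist, flux-criterion
- Literature.Barriers.QuantumFields.PerturbativeInvisibility: evaded by design — the scale e^{κβ}
appears as a THRESHOLD CROSSING of a bounded ratio of partition functions, transported by soft
inequalities (entropy / fractional moment / RP criterion), never as a coefficient of a series in g;
perturbation theory is used only below e^{(1−ε)κβ} (ExpScaleTwistSuppression), and the onset
statements are e^{−c/g²}-flat by construction.
- Literature.Barriers.QuantumFields.AbelianDeconfinementD4: every implication item carries a
group-SENSITIVE hypothesis (twist deficits of a faithful r of a compact simple G with Z(G) ≠ ⊥, or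
the ε-criterion which U(1)₄'s Coulomb phase fails: ratio = ϑ-constant, deficit O(1) at all scales);
onset statements quantify over compact simple G only; no weak-threshold criterion is filed (the
Coulomb plateau would refute it) — so `GroupBlindAreaLawD4` / the group-blind lattice-gap class are
not instantiated.
- Literature.Barriers.QuantumFields.MigdalKadanoffGroupBlindness: no decimation or approximate
recursion anywhere (the nearest prior art Tomboulis2007 died exactly here); coarse-graining is the
exact RP single-scale criterion on the true lattice (shared crux).
- Literature.Barriers.QuantumFields.FiniteTemperatureDeconfinement: only symmetric tori S⁴ and
(2S+1)⁴ (the Statement's own); Borgs–Seiler deconfinement at small temporal extent is why no thermal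
box appears.
- Literatur

Novelty grade: new-combination — ROUTE REVIEW (refuter rreview-0815T14-7-g2, 2026-08-15; 3rd refuter pass; full text REVIEW-MarginalTwistOnset.md on stmt-9806; per-item briefings by rreview-0815T14-6-0 / 0815T13-6-0 stand). Added: real-import elaboration W_ym.lean rc0, 11/11 decls + `example : Assembly := closes` (rev 2); negatives (refuter refuter-rreview-0815T14-7-g2-0, 2026-08-15T15:47:59Z; prior: Thooft1979, TomboulisYaffe1985, KovacsTomboulis2000, Tomboulis2007 (arXiv:0707.2179) + ItoSeiler2007 (arXiv:0711.4930), DerridaEtAl2009 (DGLT), GiacominToninelliLacoin2009/2010 (marginal relevance), Lacoin2009, BergerLacoin2017 (doi:10.1214/15-aihp721), sibling route-QuantumFields-FluxBootstrap (same deciding chain; shared 8949/8953/8954))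

History (route lifecycle, newest last):
- 2026-08-16T17:42:47Z · rev 4: restated FluxGapToYangMills (stmt-QuantumFields-8953), CentrelessYangMills (stmt-QuantumFields-8954), Assembly (stmt-QuantumFields-9806) — route-repair statement-revised p116790 (YangMills gained conjunct sch.HasWeakCouplingLimit): the old legs FluxGapToYangMills (8953, unpinned, conclusion untied (planner-rrepair-QuantumFields-MarginalTwistOns-0b2d0960-0)
- 2026-08-23T10:26:41Z · DORMANT — reconciler: no traction for 6.1 d (last activity statement-grounded at 2026-08-17T08:05:57Z); parked, not closed — `ledger route dormant route-QuantumFields-Mar (operator:999:933650)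
- 2026-08-28T19:24:29Z · REACTIVATED — reconciler: reactivated — activity statement-closed at 2026-08-28T16:54:14Z after parking at 2026-08-23T10:26:41Z (operator:999:2603535)
- 2026-09-03T05:48:31Z · DORMANT — reconciler: no traction for 5 d (last activity statement-checked at 2026-08-29T04:51:00Z); parked, not closed — `ledger route dormant route-QuantumFields-Margin (operator:999:197892)

sub-problem: YangMills · status: dormant · opened planner-plancard-QuantumFields-YangMills-marg-2c877845-0 2026-08-15T14:29:48Z · rev 6 · ledger route-QuantumFields-MarginalTwistOnset
GENERATED by the gate from the ledger (D-0016/17). Provers cite these decls: `theorem foo : Summit.QuantumFields.YangMills.Theses.MarginalTwistOnset.<Decl> := …` in Summits/QuantumFields/YangMills/Theorems/<Name>.lean.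
-/

namespace Summit.QuantumFields.YangMills.Theses.MarginalTwistOnset

open scoped BigOperators Topology Manifold Classical MeasureTheory ProbabilityTheory Matrix InnerProductSpace ComplexConjugate ContinuousMap
open Filter Set Function TopologicalSpace MeasureTheory

attribute [summit_statement] _root_.YangMills

/-- item stmt-QuantumFields-9799 · crux · rank 2 · open · by planner
why it might fail: It IS 't Hooft's weak-coupling criterion for all large β (⇒ area law, open: ChatterjeeYMProb2019 Pb 4.1); the DGLT tilt has no second level (a bounded-entropy tilt is equivalent to B), so B may be confinement-hard; a weak-coupling deconfined phase or sub-exponential onset for one G kills it.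
sources: Thooft1979, KovacsTomboulis2000, Tomboulis2007, ItoSeiler2007, ChatterjeeYMProb2019, BergerLacoin2017
[crux] card K1's deliverable (the missing entry made a statement). For every compact simple Lie G
and EVERY faithful unitary lattice representation r there are C > 0 and a scale function S₀ : ℝ → ℕ
with S₀(β) → ∞ and, eventually in β, S₀(β) ≤ e^{Cβ}, such that for every ε > 0, eventually in β, the
twist deficit 1 − Z_{β,S₀(β)}(z;q)/Z_{β,S₀(β)}(1;q) is ≤ ε for every central z and plane q ('t
Hooft's criterion met for all large β no later than an exponential = asymptotic-scaling-shaped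
scale; twisted partition function inline via ∀ Z, hZ → …, as in route FluxBootstrap). To be proved
DGLT-style: an O(1)-entropy change of measure at S₀(β) = ξ^{1+ε} fed by one-loop (second-moment)
control below ξ^{1−ε}, transferred by EntropyEventTransfer / FractionalMomentTransfer. [difficulty:
open-problem] -/
@[route_item "route-QuantumFields-MarginalTwistOnset"]
def ExpScaleTwistOnset : Prop :=
  ∀ (G : Type) [Group G] [TopologicalSpace G] [IsTopologicalGroup G] [CompactSpace G], Literature.MathematicalPhysics.QuantumFieldTheory.IsCompactSimpleLieGroup G → letI : MeasurableSpace G := borel G; haveI : BorelSpace G := ⟨rfl⟩; ∀ r : Literature.MathematicalPhysics.QuantumFieldTheory.LatticeRep G, ∀ Z : ℝ → ℕ → G → {p : Fin 4 × Fin 4 // p.1 < p.2} → ℝ, (∀ (β : ℝ) (L : ℕ) (z : G) (q : {p : Fin 4 × Fin 4 // p.1 < p.2}), Z β (L + 1) z q = ∫ U : Literature.MathematicalPhysics.QuantumFieldTheory.GaugeConfig 4 (L + 1) G, Real.exp (-(β * ∑ p : Literature.MathematicalPhysics.QuantumFieldTheory.Plaquette 4 (L + 1), ((r.N : ℝ)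 - (r.ρ ((if p.2 = q ∧ p.1 q.1.1 = 0 ∧ p.1 q.1.2 = 0 then z else 1) * Literature.MathematicalPhysics.QuantumFieldTheory.plaquetteHolonomy U p.1 p.2.1.1 p.2.1.2)).trace.re))) ∂(MeasureTheory.Measure.pi fun _ : Literature.MathematicalPhysics.QuantumFieldTheory.Edge 4 (L + 1) => Literature.MathematicalPhysics.QuantumFieldTheory.haarProbability G)) → ∃ C : ℝ, 0 < C ∧ ∃ S₀ : ℝ → ℕ, Filter.Tendsto S₀ Filter.atTop Filter.atTop ∧ (∀ᶠ β in Filter.atTop, ((S₀ β : ℕ) : ℝ) ≤ Real.exp (C * β)) ∧ ∀ ε : ℝ, 0 < ε → ∀ᶠ β in Filter.atTop, ∀ z ∈ Subgroup.center G, ∀ q, 1 - Z β (S₀ β) z q / Z β (S₀ β) 1 q ≤ ε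

/-- item stmt-QuantumFields-8949 · crux · rank 3 · open · by planner
why it might fail: No gluing is known: RP/chessboard bounds a doubled twist only through OPEN vortex sheets with perimeter losses (TomboulisYaffe1985); twist free energies are not known super-additive; one re-entrant deficit family (≤ ε at S₀, O(1) at S ≫ S₀; likeliest near a bulk first-order point) kills it.
sources: Thooft1979, TomboulisYaffe1985, MackPetkova1980, DobrushinShlosman1985, BhanotCreutz1981, Greensite2011Confinement
[crux] card item F1 = FB(a) only. For every compact metrisable group G and continuous unitary ρ : G
→ U(N) there are ε, c, C > 0 such that for every β ≥ 0 and all torus sizes 2 ≤ S₀ ≤ S: if the twist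
deficit 1 − Z_{β,S₀}(z;q)/Z_{β,S₀}(1) is ≤ ε for every central z and every plane q, then |1 −
Z_{β,S}(z;q)/Z_{β,S}(1)| ≤ C exp(−c S²/S₀²) for every central z and plane q. The twisted partition
function enters through its defining formula (∀ Z, hZ → …; definition request below). [difficulty:
open-problem] -/
@[route_item "route-QuantumFields-MarginalTwistOnset"]
def SingleScaleFluxCriterion : Prop :=
  ∀ (G : Type) [Group G] [TopologicalSpace G] [IsTopologicalGroup G] [CompactSpace G] [T2Space G] [SecondCountableTopology G] [MeasurableSpace G] [BorelSpace G] (N : ℕ) (ρ : G →* Matrix (Fin N) (Fin N) ℂ), Continuous ρ → (∀ g, ρ g ∈ Matrix.unitaryGroup (Fin N) ℂ) → ∀ Z : ℝ → ℕ → G → {p : Fin 4 × Fin 4 // p.1 < p.2} → ℝ, (∀ (β : ℝ) (L : ℕ) (z : G) (q : {p : Fin 4 × Fin 4 // p.1 < p.2}), Z β (L + 1) z q = ∫ U : Literature.MathematicalPhysics.QuantumFieldTheory.GaugeConfig 4 (L + 1) G, Real.exp (-(β * ∑ p : Literature.MathematicalPhysics.QuantumFieldTheory.Plaquette 4 (L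 + 1), ((N : ℝ) - (ρ ((if p.2 = q ∧ p.1 q.1.1 = 0 ∧ p.1 q.1.2 = 0 then z else 1) * Literature.MathematicalPhysics.QuantumFieldTheory.plaquetteHolonomy U p.1 p.2.1.1 p.2.1.2)).trace.re))) ∂(MeasureTheory.Measure.pi fun _ : Literature.MathematicalPhysics.QuantumFieldTheory.Edge 4 (L + 1) => Literature.MathematicalPhysics.QuantumFieldTheory.haarProbability G)) → ∃ ε c C : ℝ, 0 < ε ∧ 0 < c ∧ 0 < C ∧ ∀ β : ℝ, 0 ≤ β → ∀ S₀ S : ℕ, 2 ≤ S₀ → S₀ ≤ S → (∀ z ∈ Subgroup.center G, ∀ q, 1 - Z β S₀ z q / Z β S₀ 1 q ≤ ε) → ∀ z ∈ Subgroup.center G, ∀ q, |1 - Z β S z q / Z β S 1 q| ≤ C * Real.exp (-(c * ((S : ℝ) / S₀) ^ 2))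

/-- item stmt-QuantumFields-9800 · crux · rank 4 · open · by planner
why it might fail: σ>0 ⇏ gap: no bound m ≥ c√σ known for any (G,r), only the converse (strong mixing ⇒ area law, Chatterjee2021 Thm 2.4); twist ratios are blind to centre-neutral light states (0⁺⁺ softening near a fundamental–adjoint endpoint met by an exotic reducible r); β ≥ β₁ only removes bounded-β transitions.
sources: TomboulisYaffe1985, Chatterjee2021, ChatterjeeYMProb2019, BhanotCreutz1981, doi:10.1016/0370-2693(95)01186-t, ForcrandSmekal2002
[crux] confinement scale ⇒ gap at weak coupling, in the shape the glue needs and AUDITED against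
vacuity (planner's variant of FluxBootstrap.FluxScaleControlsGap, which is refutable: for centreless
G its hypothesis is vacuous and it asserts β-uniform clustering). For every compact simple Lie G
with Z(G) ≠ 1, every faithful r and all c, C > 0 there are m > 0 and β₁ such that for all
gauge-invariant local A, B there is K with: for every β ≥ β₁ and S₀ ≥ 2, if |deficit_{β,S}(z;q)| ≤ C
e^{−cS²/S₀²} for all S ≥ S₀, central z and planes q, then |⟨A;τ_n B⟩_{β,(2S+1)⁴}| ≤ K e^{−m n/S₀}
for all S ≥ S₀, n ≤ S (exactly the latticeConnectedCorr of HasLatticeMassGap). [deps: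
SingleScaleFluxCriterion] [difficulty: open-problem] -/
@[route_item "route-QuantumFields-MarginalTwistOnset"]
def LargeBetaFluxGap : Prop :=
  ∀ (G : Type) [Group G] [TopologicalSpace G] [IsTopologicalGroup G] [CompactSpace G], Literature.MathematicalPhysics.QuantumFieldTheory.IsCompactSimpleLieGroup G → Subgroup.center G ≠ ⊥ → letI : MeasurableSpace G := borel G; haveI : BorelSpace G := ⟨rfl⟩; ∀ r : Literature.MathematicalPhysics.QuantumFieldTheory.LatticeRep G, ∀ Z : ℝ → ℕ → G → {p : Fin 4 × Fin 4 // p.1 < p.2} → ℝ, (∀ (β : ℝ) (L : ℕ) (z : G) (q : {p : Fin 4 × Fin 4 // p.1 < p.2}), Z β (L + 1) z q = ∫ U : Literature.MathematicalPhysics.QuantumFieldTheory.GaugeConfig 4 (L + 1) G, Real.exp (-(β * ∑ p : Literature.MathematicalPhysics.QuantumFieldTheory.Plaquette 4 (L + 1), ((r.N : ℝ) - (r.ρ ((if p.2 = q ∧ p.1 q.1.1 = 0 ∧ p.1 q.1.2 = 0 then z else 1) * Literature.MathematicalPhysics.QuantumFieldTheory.plaquetteHolonomy U p.1 p.2.1.1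 p.2.1.2)).trace.re))) ∂(MeasureTheory.Measure.pi fun _ : Literature.MathematicalPhysics.QuantumFieldTheory.Edge 4 (L + 1) => Literature.MathematicalPhysics.QuantumFieldTheory.haarProbability G)) → ∀ c C : ℝ, 0 < c → 0 < C → ∃ m β₁ : ℝ, 0 < m ∧ ∀ A B : Literature.MathematicalPhysics.QuantumFieldTheory.YMSpecies G, ∃ K : ℝ, ∀ β : ℝ, β₁ ≤ β → ∀ S₀ : ℕ, 2 ≤ S₀ → (∀ S : ℕ, S₀ ≤ S → ∀ z ∈ Subgroup.center G, ∀ q, |1 - Z β S z q / Z β S 1 q| ≤ C * Real.exp (-(c * ((S : ℝ) / S₀) ^ 2))) → ∀ S : ℕ, S₀ ≤ S → ∀ n : ℕ, n ≤ S → |Literature.MathematicalPhysics.QuantumFieldTheory.latticeConnectedCorr r.ρ β (2 * S + 1) A.F B.F n| ≤ K * Real.exp (-(m * n / S₀))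

/-- item stmt-QuantumFields-9801 · crux · rank 5 · open · by planner
why it might fail: ONE exponential rate κ for both the end of the femto regime and the confinement onset; power-law (two-loop, Λ-ratio) prefactors are absorbed by ε, but an intermediate window of width e^{δβ} where the twist ratio plateaus at an O(1) value (as U(1)'s ϑ-constant does at all scales) kills it.
sources: Luscher1983, KollerVanbaal1986, GonzalezarroyoAltes1988, DanielGonzalezarroyoKorthalsaltes1990, ForcrandSmekal2002, BergerLacoin2017
[crux] the signature prediction of the transplant (Berger–Lacoin's lim β² log Δf = −π in twist
language, with an INTRINSIC rate instead of b₀): for every compact simple Lie G and faithful r there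
is ONE κ > 0 such that for all ε, η > 0, eventually in β: (suppression, the femto/Bałaban window)
Z_{β,S}(z;q)/Z_{β,S}(1;q) ≤ η for every central z ≠ 1, every plane and all 2 ≤ S ≤ e^{(1−ε)κβ};
(onset) 1 − Z_{β,S}(z;q)/Z_{β,S}(1;q) ≤ η for every central z, plane and all S ≥ e^{(1+ε)κβ}.
Expected κ_r = 12π²/(11N) for SU(N) fundamental in the tree's action normalisation (24π²T_r/(11h^∨)
in general); implies ExpScaleTwistOnset (support SharpImpliesOnset, proved in Sketch.lean) and
ExpScaleTwistSuppression. [deps: ExpScaleTwistOnset] [difficulty: open-problem] -/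
@[route_item "route-QuantumFields-MarginalTwistOnset"]
def SharpTwistTransmutation : Prop :=
  ∀ (G : Type) [Group G] [TopologicalSpace G] [IsTopologicalGroup G] [CompactSpace G], Literature.MathematicalPhysics.QuantumFieldTheory.IsCompactSimpleLieGroup G → letI : MeasurableSpace G := borel G; haveI : BorelSpace G := ⟨rfl⟩; ∀ r : Literature.MathematicalPhysics.QuantumFieldTheory.LatticeRep G, ∀ Z : ℝ → ℕ → G → {p : Fin 4 × Fin 4 // p.1 < p.2} → ℝ, (∀ (β : ℝ) (L : ℕ) (z : G) (q : {p : Fin 4 × Fin 4 // p.1 < p.2}), Z β (L + 1) z q = ∫ U : Literature.MathematicalPhysics.QuantumFieldTheory.GaugeConfig 4 (L + 1) G, Real.exp (-(β * ∑ p : Literature.MathematicalPhysics.QuantumFieldTheory.Plaquette 4 (L + 1), ((r.N : ℝ) - (r.ρ ((if p.2 = q ∧ p.1 q.1.1 = 0 ∧ p.1 q.1.2 = 0 then z else 1) * Literature.MathematicalPhysics.QuantumFieldTheory.plaquetteHolonomy U p.1 p.2.1.1 p.2.1.2)).trace.re))) ∂(MeasureTheory.Measure.pi fun _ : Literature.MathematicalPhysics.QuantumFieldTheory.Edge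 4 (L + 1) => Literature.MathematicalPhysics.QuantumFieldTheory.haarProbability G)) → ∃ κ : ℝ, 0 < κ ∧ ∀ ε η : ℝ, 0 < ε → 0 < η → ∀ᶠ β in Filter.atTop, (∀ S : ℕ, 2 ≤ S → (S : ℝ) ≤ Real.exp ((1 - ε) * κ * β) → ∀ z ∈ Subgroup.center G, z ≠ 1 → ∀ q, Z β S z q / Z β S 1 q ≤ η) ∧ (∀ S : ℕ, Real.exp ((1 + ε) * κ * β) ≤ (S : ℝ) → ∀ z ∈ Subgroup.center G, ∀ q, 1 - Z β S z q / Z β S 1 q ≤ η)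

/-- item stmt-QuantumFields-10477 · crux · rank 9 · open · by planner
why it might fail: Carries the whole continuum limit: clustering at the pinned flux scale gives tightness at best; joint convergence of ALL species on ⁰𝒮 along one subsequence, E1 (full O(4) invariance) and non-Gaussianity of tr F² at ℓ* are each open for Wilson's action and may fail.
sources: JaffeWitten2000, OsterwalderSeilerAnnPhys1978, Balaban1989LargeFieldII, Seiler1982, ChatterjeeYMProb2019
[support] the OS LEGS fed by THIS route's flux side, with the anchor's two-sided pinning threaded
through (repairs the structural objection of rreview-0815T13-6 / 0815T14-6 to FluxGapToYangMills
stmt-QuantumFields-8953, whose hypothesis did not tie S₀(k) to β_k and was therefore met by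
oversized scales carrying no continuum information). For every compact simple Lie G with Z(G) ≠ 1,
every faithful r : LatticeRep G (Z = its twisted Wilson partition function via hZ), every ε ∈ (0,1),
m > 0, couplings β_k ≥ 0 with β_k → ∞ and scales S₀(k) → ∞: IF eventually in k the ε-criterion holds
at S₀(k) (twist deficit ≤ ε for all central z and planes) AND fails at some S' with S₀(k) ≤ 2S' (the
flux scale is the physical scale ℓ*: S₀(k) is NOT oversized), AND all gauge-invariant local A, B
cluster at rate m/S₀(k) uniformly on the tori (2S+1)⁴, S ≥ S₀(k) (exactly what ContinuumFluxAnchor +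
SingleScaleFluxCriterion + LargeBetaFluxGap deliver), THEN the `YangMills` clause holds for G IN THE
SAME REPRESENTATION r and ALONG A SUBSEQUENCE of (β_k): ∃ sch T with sch.β = β ∘ φ (φ strictly
increasing), tori L_k ≥ S₀(φ k), IsYangMillsFor r sch T, non-trivial non-Gaussian curvature,
T.HasMassGap Δ ∧ HasLatt -/
@[route_item "route-QuantumFields-MarginalTwistOnset"]
def PinnedFluxGapToYangMills : Prop :=
  ∀ (G : Type) [Group G] [TopologicalSpace G] [IsTopologicalGroup G] [CompactSpace G], Literature.MathematicalPhysics.QuantumFieldTheory.IsCompactSimpleLieGroup G → Subgroup.center G ≠ ⊥ → letI : MeasurableSpace G := borel G; haveI : BorelSpace G := ⟨rfl⟩; ∀ (r : Literature.MathematicalPhysics.QuantumFieldTheory.LatticeRep G) (Z : ℝ → ℕ → G → {p : Fin 4 × Fin 4 // p.1 < p.2} → ℝ), (∀ (β : ℝ) (L : ℕ) (z : G) (q : {p : Fin 4 × Fin 4 // p.1 < p.2}), Z β (L + 1) z q = ∫ U : Literature.MathematicalPhysics.QuantumFieldTheory.GaugeConfig 4 (L + 1) G, Real.exp (-(β * ∑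 p : Literature.MathematicalPhysics.QuantumFieldTheory.Plaquette 4 (L + 1), ((r.N : ℝ) - (r.ρ ((if p.2 = q ∧ p.1 q.1.1 = 0 ∧ p.1 q.1.2 = 0 then z else 1) * Literature.MathematicalPhysics.QuantumFieldTheory.plaquetteHolonomy U p.1 p.2.1.1 p.2.1.2)).trace.re))) ∂(MeasureTheory.Measure.pi fun _ : Literature.MathematicalPhysics.QuantumFieldTheory.Edge 4 (L + 1) => Literature.MathematicalPhysics.QuantumFieldTheory.haarProbability G)) → ∀ (ε m : ℝ) (β : ℕ → ℝ) (S₀ : ℕ → ℕ), 0 < ε → ε < 1 → 0 < m → (∀ k, 0 ≤ β k) → Filter.Tendsto β Filter.atTop Filter.atTop → Filter.Tendsto S₀ Filter.atTop Filter.atTop → (∀ᶠ k in Filter.atTop, (∀ z ∈ Subgroup.center G, ∀ q, 1 - Z (β k) (S₀ k) z q / Z (β k) (S₀ k) 1 q ≤ ε) ∧ (∃ S' : ℕ, 2 ≤ S' ∧ S₀ k ≤ 2 * S' ∧ ∃ z ∈ Subgroup.center G, ∃ q, ε < 1 - Z (β k) S' z q / Z (β k) S' 1 q)) → (∀ A B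 : Literature.MathematicalPhysics.QuantumFieldTheory.YMSpecies G, ∃ K : ℝ, ∀ᶠ k in Filter.atTop, ∀ S : ℕ, S₀ k ≤ S → ∀ n : ℕ, n ≤ S → |Literature.MathematicalPhysics.QuantumFieldTheory.latticeConnectedCorr r.ρ (β k) (2 * S + 1) A.F B.F n| ≤ K * Real.exp (-(m * n / S₀ k))) → ∃ (sch : Literature.MathematicalPhysics.QuantumFieldTheory.SpeciesScheme (Literature.MathematicalPhysics.QuantumFieldTheory.YMSpecies G)) (T : Literature.MathematicalPhysics.QuantumFieldTheory.OSData (Literature.MathematicalPhysics.QuantumFieldTheory.YMSpecies G) 4), (∃ φ : ℕ → ℕ, StrictMono φ ∧ ∀ k, sch.β k = β (φ k) ∧ S₀ (φ k) ≤ sch.L k) ∧ Literature.MathematicalPhysics.QuantumFieldTheory.IsYangMillsFor r sch T ∧ T.IsNontrivial r.curvature ∧ T.IsNonGaussian r.curvature ∧ ∃ Δ > 0, T.HasMassGap Δ ∧ Literature.MathematicalPhysics.QuantumFieldTheory.HasLatticeMassGap r sch Δ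

/-- item stmt-QuantumFields-15941 · crux · rank 9 · open · by planner
why it might fail: It IS the summit clause for PSU(N), SO(2n+1), PSp(n), PSO(2n), E₆/ℤ₃, E₇/ℤ₂, G₂, F₄, E₈: G₂/F₄/E₈ have no twist sectors at all (HollandEtAl2003) and descent of OS data from the cover for adjoint forms (ForcrandJahn2002) is unproved; false iff Yang–Mills fails for a centreless G.
sources: JaffeWitten2000, Greensite2011Confinement, HollandEtAl2003, ForcrandJahn2002
[support] the REVISED `YangMills` clause (statement re-type 2026-08-16, p116790: first conjunct
`sch.HasWeakCouplingLimit`, i.e. β_k = 2/g₀² → ∞ along the scheme) for compact simple Lie G with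
TRIVIAL centre (adjoint forms PSU(N), SO(2n+1), PSp(n), PSO(2n), E₆/ℤ₃, E₇/ℤ₂ and the centreless
simply connected G₂, F₄, E₈), where the twist criterion is void — NOT this route's claim (card
adjoint-forms-flux-uniform-quantifier: covering reduction, whose K1 is flux-sector control of the
cover, supplied by cruxes 2–4; G₂/F₄/E₈ need another mechanism). Supersedes CentrelessYangMills
(stmt-QuantumFields-8954, the pre-revision clause, kept by route MarginalTwistOnset) for this route:
the weak-coupling conjunct cannot be manufactured from the old clause, so it is carried as part of
this delegated leg. [difficulty: open-problem] -/
@[route_item "route-QuantumFields-MarginalTwistOnset"]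
def CentrelessWeakCouplingYangMills : Prop :=
  ∀ (G : Type) [Group G] [TopologicalSpace G] [IsTopologicalGroup G] [CompactSpace G], Literature.MathematicalPhysics.QuantumFieldTheory.IsCompactSimpleLieGroup G → Subgroup.center G = ⊥ → letI : MeasurableSpace G := borel G; haveI : BorelSpace G := ⟨rfl⟩; ∃ (r : Literature.MathematicalPhysics.QuantumFieldTheory.LatticeRep G) (sch : Literature.MathematicalPhysics.QuantumFieldTheory.SpeciesScheme (Literature.MathematicalPhysics.QuantumFieldTheory.YMSpecies G)) (T : Literature.MathematicalPhysics.QuantumFieldTheory.OSData (Literature.MathematicalPhysics.QuantumFieldTheory.YMSpecies G) 4), sch.HasWeakCouplingLimit ∧ Literature.MathematicalPhysics.QuantumFieldTheory.IsYangMillsFor r sch T ∧ T.IsNontrivial r.curvature ∧ T.IsNonGaussian r.curvature ∧ ∃ Δ > 0, T.HasMassGap Δ ∧ Literature.MathematicalPhysics.QuantumFieldTheory.HasLatticeMassGap r sch Δ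

/-- item stmt-QuantumFields-16128 · crux · rank 9 · open · by planner
why it might fail: Fixed-lattice β→∞ Laplace asymptotics on SINGULAR flat-connection varieties: if for some compact simple G, faithful r, size S every twisted sector z ≠ 1 had a stratum whose toron exponent (quartic modes, logs) tied the periodic one, min_z Z(z)/Z(1) ↛ 0; only SU(N), z a generator, is Morse–Bott.
sources: Thooft1979, Luscher1983, GonzalezarroyoAltes1988, KollerVanbaal1986, ForcrandSmekal2002, arXiv:math/9907007
[support] 't Hooft's criterion FAILS in the femto universe — the classical limit β → ∞ on a FIXED
lattice (added at the route repair of 2026-08-16, statement re-type p116790, as the weakest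
femto-side input that PINS the flux scale in `closes`): for every compact simple Lie G with Z(G) ≠
1, every faithful unitary lattice representation r (Z = its twisted Wilson partition function via
hZ, as in the other items), every torus size S ≥ 2 and every ε < 1, eventually in β some twist
deficit 1 − Z_{β,S}(z;q)/Z_{β,S}(1;q), z ∈ Z(G), exceeds ε — equivalently min_{z,q}
Z_{β,S}(z;q)/Z_{β,S}(1;q) → 0 as β → ∞ at fixed S. Why true: finite-dimensional Laplace asymptotics
on G^{edges}; both sectors have zero minimal action (twist-eating flat connections exist: every
central element of a connected compact semisimple group is a commutator), but the periodic sector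
contains the trivial connection with its 4·dim G quartic zero-momentum (toron) modes, whereas every
z-twisted flat connection, z ≠ 1, has its zero modes valued in the PROPER centraliser of a pair with
commutator z, so Z(z)/Z(1) decays like a negative power of β (for SU(N) and z a generator of the
centre the twisted flat connections are is -/
@[route_item "route-QuantumFields-MarginalTwistOnset"]
def FixedTorusCriterionFailure : Prop :=
  ∀ (G : Type) [Group G] [TopologicalSpace G] [IsTopologicalGroup G] [CompactSpace G], Literature.MathematicalPhysics.QuantumFieldTheory.IsCompactSimpleLieGroup G → Subgroup.center G ≠ ⊥ → letI : MeasurableSpace G := borel G; haveI : BorelSpace G := ⟨rfl⟩; ∀ r : Literature.MathematicalPhysics.QuantumFieldTheory.LatticeRep G, ∀ Z : ℝ → ℕ → G → {p : Fin 4 × Fin 4 // p.1 < p.2} → ℝ, (∀ (β : ℝ) (L : ℕ) (z : G) (q : {p : Fin 4 × Fin 4 // p.1 < p.2}), Z β (L + 1) z q = ∫ U : Literature.MathematicalPhysics.QuantumFieldTheory.GaugeConfig 4 (L + 1) G, Real.exp (-(β * ∑ p : Literature.MathematicalPhysics.QuantumFieldTheory.Plaquette 4 (L + 1), ((r.N :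 ℝ) - (r.ρ ((if p.2 = q ∧ p.1 q.1.1 = 0 ∧ p.1 q.1.2 = 0 then z else 1) * Literature.MathematicalPhysics.QuantumFieldTheory.plaquetteHolonomy U p.1 p.2.1.1 p.2.1.2)).trace.re))) ∂(MeasureTheory.Measure.pi fun _ : Literature.MathematicalPhysics.QuantumFieldTheory.Edge 4 (L + 1) => Literature.MathematicalPhysics.QuantumFieldTheory.haarProbability G)) → ∀ S : ℕ, 2 ≤ S → ∀ ε : ℝ, ε < 1 → ∀ᶠ β in Filter.atTop, ∃ z ∈ Subgroup.center G, ∃ q, ε < 1 - Z β S z q / Z β S 1 q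

/-- item stmt-QuantumFields-9802 · support · rank 9 · open · by planner
sources: Luscher1983, GonzalezarroyoAltes1988, DanielGonzalezarroyoKorthalsaltes1990, Balaban1989LargeFieldII
[support] the perturbative half of the dictionary (weak disorder below N*^{1−ε} ↔ femto universe
below ξ^{1−ε}), where Bałaban's small-field technology should reach: for every compact simple Lie G
and faithful r there is c > 0 such that for every η > 0, eventually in β, Z_{β,S}(z;q)/Z_{β,S}(1;q)
≤ η for every central z ≠ 1, every plane and all 2 ≤ S ≤ e^{cβ} (twist-eating flat connections have
fewer moduli than periodic ones; the twisted sector is suppressed by a power of the running coupling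
throughout the window). With ExpScaleTwistOnset it brackets the onset scale between two
exponentials. [difficulty: XL] -/
@[route_item "route-QuantumFields-MarginalTwistOnset"]
def ExpScaleTwistSuppression : Prop :=
  ∀ (G : Type) [Group G] [TopologicalSpace G] [IsTopologicalGroup G] [CompactSpace G], Literature.MathematicalPhysics.QuantumFieldTheory.IsCompactSimpleLieGroup G → letI : MeasurableSpace G := borel G; haveI : BorelSpace G := ⟨rfl⟩; ∀ r : Literature.MathematicalPhysics.QuantumFieldTheory.LatticeRep G, ∀ Z : ℝ → ℕ → G → {p : Fin 4 × Fin 4 // p.1 < p.2} → ℝ, (∀ (β : ℝ) (L : ℕ) (z : G) (q : {p : Fin 4 × Fin 4 // p.1 < p.2}), Z β (L + 1) z q = ∫ U : Literature.MathematicalPhysics.QuantumFieldTheory.GaugeConfig 4 (L + 1) G, Real.exp (-(β * ∑ p : Literature.MathematicalPhysics.QuantumFieldTheory.Plaquette 4 (L + 1), ((r.N : ℝ) - (r.ρ ((if p.2 = q ∧ p.1 q.1.1 = 0 ∧ p.1 q.1.2 = 0 then z else 1) * Literature.MathematicalPhysics.QuantumFieldTheory.plaquetteHolonomy U p.1 p.2.1.1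 p.2.1.2)).trace.re))) ∂(MeasureTheory.Measure.pi fun _ : Literature.MathematicalPhysics.QuantumFieldTheory.Edge 4 (L + 1) => Literature.MathematicalPhysics.QuantumFieldTheory.haarProbability G)) → ∃ c : ℝ, 0 < c ∧ ∀ η : ℝ, 0 < η → ∀ᶠ β in Filter.atTop, ∀ S : ℕ, 2 ≤ S → (S : ℝ) ≤ Real.exp (c * β) → ∀ z ∈ Subgroup.center G, z ≠ 1 → ∀ q, Z β S z q / Z β S 1 q ≤ η

/-- item stmt-QuantumFields-9803 · support · rank 9 · closed · proved by Summit.QuantumFields.YangMills.Theorems.MarginalTwistOnsetGlue.sharpImpliesOnset_proof (prover) · by planner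
sources: BergerLacoin2017
[support] pure logic + Nat.ceil bookkeeping (proved sorry-free in the planner's Sketch.lean, theorem
sharpImpliesOnset_holds): the sharp two-sided statement gives ExpScaleTwistOnset with C = 3κ and
S₀(β) = ⌈e^{2κβ}⌉. [difficulty: provable-now] -/
@[route_item "route-QuantumFields-MarginalTwistOnset"]
def SharpImpliesOnset : Prop :=
  SharpTwistTransmutation → ExpScaleTwistOnset

-- `SharpImpliesOnset` holds: proved by `Summit.QuantumFields.YangMills.Theorems.MarginalTwistOnsetGlue.sharpImpliesOnset_proof` (its module imports this route file, so no `_holds` link can be stated here).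

/-- item stmt-QuantumFields-9804 · support · rank 9 · closed · proved by Summit.QuantumFields.YangMills.Theorems.marginalTwistOnset_entropyEventTransfer_proof (prover) · by planner
sources: GiacominToninelliLacoin2009, DerridaEtAl2009, Lacoin2009
[support] (M2, entropy form) the change-of-measure inequality of the disorder-relevance method over
Mathlib's `InformationTheory.klDiv`: for probability measures μ, ν with H(ν|μ) = klDiv ν μ < ∞ and
an event A with ν(A) > 0, μ(A) ≥ ν(A)·exp(−(H(ν|μ) + e⁻¹)/ν(A)) (Jensen on A and Aᶜ plus x log x ≥
−e⁻¹). [difficulty: provable-now] -/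
@[route_item "route-QuantumFields-MarginalTwistOnset"]
def EntropyEventTransfer : Prop :=
  ∀ {Ω : Type} [MeasurableSpace Ω] (μ ν : MeasureTheory.Measure Ω) [MeasureTheory.IsProbabilityMeasure μ] [MeasureTheory.IsProbabilityMeasure ν] (A : Set Ω), MeasurableSet A → InformationTheory.klDiv ν μ ≠ ⊤ → 0 < ν A → ν.real A * Real.exp (-(((InformationTheory.klDiv ν μ).toReal + Real.exp (-1)) / ν.real A)) ≤ μ.real A

-- `EntropyEventTransfer` holds: proved by `Summit.QuantumFields.YangMills.Theorems.marginalTwistOnset_entropyEventTransfer_proof` (its module imports this route file, so no `_holds` link can be stated here).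

/-- item stmt-QuantumFields-9805 · support · rank 9 · closed · proved by Summit.QuantumFields.YangMills.Theorems.marginalTwistOnset_fractionalMomentTransfer_proof (prover) · by planner
sources: DerridaEtAl2009, Lacoin2009, BergerLacoin2017
[support] (M2, fractional-moment form) Hölder transfer of a fractional moment to a tilted first
moment: for probability measures μ ≪ ν, measurable f ≥ 0 and θ ∈ (0,1), ∫ f^θ dμ ≤ (∫ f dν)^θ (∫
(dμ/dν)^{1/(1−θ)} dν)^{1−θ} (lintegrals; `ENNReal.lintegral_mul_le_Lp_mul_Lq` with p = 1/θ, q =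
1/(1−θ) after ∫ f^θ dμ = ∫ f^θ (dμ/dν) dν). [difficulty: provable-now] -/
@[route_item "route-QuantumFields-MarginalTwistOnset"]
def FractionalMomentTransfer : Prop :=
  ∀ {Ω : Type} [MeasurableSpace Ω] (μ ν : MeasureTheory.Measure Ω) [MeasureTheory.IsProbabilityMeasure μ] [MeasureTheory.IsProbabilityMeasure ν], μ ≪ ν → ∀ f : Ω → ENNReal, Measurable f → ∀ θ : ℝ, 0 < θ → θ < 1 → ∫⁻ x, f x ^ θ ∂μ ≤ (∫⁻ x, f x ∂ν) ^ θ * (∫⁻ x, μ.rnDeriv ν x ^ (1 / (1 - θ)) ∂ν) ^ (1 - θ)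

-- `FractionalMomentTransfer` holds: proved by `Summit.QuantumFields.YangMills.Theorems.marginalTwistOnset_fractionalMomentTransfer_proof` (its module imports this route file, so no `_holds` link can be stated here).

-- earlier Assembly (stmt-QuantumFields-9806, replaced 2026-08-16T17:42:47Z -> stmt-QuantumFields-16127): retired by None — ExpScaleTwistOnset → SingleScaleFluxCriterion → LargeBetaFluxGap → FluxGapToYangMills → CentrelessYangMills → YangMills
/-- item stmt-QuantumFields-16127 · assembly · rank 1 · closed · proved by Summit.QuantumFields.YangMills.Theorems.MarginalTwistOnsetGlue.assembly_proof (prover) · by planner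
sources: JaffeWitten2000, Thooft1979
[assembly] ExpScaleTwistOnset → FixedTorusCriterionFailure → SingleScaleFluxCriterion →
LargeBetaFluxGap → PinnedFluxGapToYangMills → CentrelessWeakCouplingYangMills → YangMills (the
sub-problem constant `YangMills` of Summits/QuantumFields/YangMills/Statement.lean is at root
namespace); = the type of the deciding theorem `closes` after the repair of 2026-08-16 (statement
re-type p116790: the weak-coupling conjunct is proved in `closes` from β_k = k → ∞ through the legs'
subsequence clause). -/
@[route_item "route-QuantumFields-MarginalTwistOnset"]
def Assembly : Prop :=
  ExpScaleTwistOnset → FixedTorusCriterionFailure → SingleScaleFluxCriterion → LargeBetaFluxGap → PinnedFluxGapToYangMills → CentrelessWeakCouplingYangMills → YangMills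

-- `Assembly` holds: proved by `Summit.QuantumFields.YangMills.Theorems.MarginalTwistOnsetGlue.assembly_proof` (its module imports this route file, so no `_holds` link can be stated here).

-- records of items no longer active in this route (dropped / restated):
-- earlier FluxGapToYangMills (stmt-QuantumFields-8953, replaced 2026-08-16T17:42:47Z -> stmt-QuantumFields-10477): retired by None — ∀ (G : Type) [Group G] [TopologicalSpace G] [IsTopologicalGroup G] [CompactSpace G], Literature.MathematicalPhysics.QuantumFieldTheory.IsCompactSimpleLieGroup G → letI : MeasurableSpace G := borel G; haveI : BorelSpace G := ⟨rfl⟩; (∃ (r : Literature.MathematicalPhysics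
-- earlier CentrelessYangMills (stmt-QuantumFields-8954, replaced 2026-08-16T17:42:47Z -> stmt-QuantumFields-15941): retired by None — ∀ (G : Type) [Group G] [TopologicalSpace G] [IsTopologicalGroup G] [CompactSpace G], Literature.MathematicalPhysics.QuantumFieldTheory.IsCompactSimpleLieGroup G → Subgroup.center G = ⊥ → letI : MeasurableSpace G := borel G; haveI : BorelSpace G := ⟨rfl⟩; ∃ (r : Litera

/-! D-0027 §2.1 — DECIDING THEOREM (planner-authored via `route open/edit --closes-file`; by planner-rrepair-QuantumFields-MarginalTwistOns-0b2d0960-0 2026-08-16T17:42:47Z):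
its hypotheses are this route's items and its conclusion the sub-problem Statement (glue_lint), and it elaborates with this file. -/

/-- ROUTE GLUE (D-0027 §2.1), PURE LOGIC plus instance and `Nat.find` bookkeeping: the listed items
imply the sub-problem statement `YangMills` (re-typed 2026-08-16 with the weak-coupling conjunct
`sch.HasWeakCouplingLimit`). Fix `G`; if `Z(G) = ⊥` use `CentrelessWeakCouplingYangMills`.
Otherwise take a faithful `r` from `IsCompactSimpleLieGroup G` (T2 / second countability of `G` from
the closed embedding `r.ρ`), instantiate the twisted partition function by its defining integral,
get `(ε, c, C)` from `SingleScaleFluxCriterion`, `(m, β₁)` from `LargeBetaFluxGap`, and along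
`β_k := k → ∞` let `S₀ k` be the LEAST torus size `≥ 2` at which the `min ε ½`-criterion holds —
it exists for large `k` by `ExpScaleTwistOnset`, it diverges by `FixedTorusCriterionFailure`
(at every fixed size the criterion eventually fails), and by minimality the criterion fails at the
comparable size `S₀ k - 1`: the flux scale is PINNED. The criterion at `S₀ k` gives Gaussian twist
decay above `S₀ k`, `LargeBetaFluxGap` (eventually `β_k ≥ β₁`) turns it into volume-uniform
clustering at rate `m / S₀ k`, and `PinnedFluxGapToYangMills`, fed the same `r`, the pin and the
clustering, returns a scheme whose couplings are a subsequence `β ∘ φ` of `β_k = k` — hence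
`HasWeakCouplingLimit` — with the OS data, non-triviality, non-Gaussianity and both gaps. -/
@[closes "route-QuantumFields-MarginalTwistOnset"] theorem closes : ExpScaleTwistOnset → FixedTorusCriterionFailure → SingleScaleFluxCriterion →
    LargeBetaFluxGap → PinnedFluxGapToYangMills → CentrelessWeakCouplingYangMills → YangMills := by
  intro hOn hFail hFB hGap hLegs hCentreless G _ _ _ _ hG
  letI : MeasurableSpace G := borel G
  haveI : BorelSpace G := ⟨rfl⟩
  by_cases hc : Subgroup.center G = ⊥
  · exact hCentreless G hG hc
  · obtain ⟨r⟩ := hG.2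
    have hemb := r.continuous.isClosedEmbedding r.injective
    haveI : T2Space G := hemb.isEmbedding.t2Space
    haveI : SecondCountableTopology G := hemb.isEmbedding.secondCountableTopology
    let Z : ℝ → ℕ → G → {p : Fin 4 × Fin 4 // p.1 < p.2} → ℝ := fun β S z q =>
      match S with
      | 0 => 0
      | L + 1 => ∫ U : Literature.MathematicalPhysics.QuantumFieldTheory.GaugeConfig 4 (L + 1) G,
          Real.exp (-(β * ∑ p : Literature.MathematicalPhysics.QuantumFieldTheory.Plaquette 4 (L + 1),
            ((r.N : ℝ) - (r.ρ ((if p.2 = q ∧ p.1 q.1.1 = 0 ∧ p.1 q.1.2 = 0 then z else 1) *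
              Literature.MathematicalPhysics.QuantumFieldTheory.plaquetteHolonomy U p.1 p.2.1.1
                p.2.1.2)).trace.re)))
          ∂(MeasureTheory.Measure.pi fun _ :
              Literature.MathematicalPhysics.QuantumFieldTheory.Edge 4 (L + 1) =>
            Literature.MathematicalPhysics.QuantumFieldTheory.haarProbability G)
    have hZ : ∀ (β : ℝ) (L : ℕ) (z : G) (q : {p : Fin 4 × Fin 4 // p.1 < p.2}), Z β (L + 1) z q =
        ∫ U : Literature.MathematicalPhysics.QuantumFieldTheory.GaugeConfig 4 (L + 1) G,
          Real.exp (-(β * ∑ p : Literature.MathematicalPhysics.QuantumFieldTheory.Plaquette 4 (L + 1),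
            ((r.N : ℝ) - (r.ρ ((if p.2 = q ∧ p.1 q.1.1 = 0 ∧ p.1 q.1.2 = 0 then z else 1) *
              Literature.MathematicalPhysics.QuantumFieldTheory.plaquetteHolonomy U p.1 p.2.1.1
                p.2.1.2)).trace.re)))
          ∂(MeasureTheory.Measure.pi fun _ :
              Literature.MathematicalPhysics.QuantumFieldTheory.Edge 4 (L + 1) =>
            Literature.MathematicalPhysics.QuantumFieldTheory.haarProbability G) :=
      fun _ _ _ _ => rfl
    obtain ⟨C₀, hC₀, S₁, hS₁, -, hε⟩ := hOn G hG r Z hZ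
    obtain ⟨ε, c, C, hεpos, hc0, hC0, hfb⟩ := hFB G r.N r.ρ r.continuous r.mem_unitary Z hZ
    obtain ⟨m, β₁, hm, hgap⟩ := hGap G hG hc r Z hZ c C hc0 hC0
    have hε' : 0 < min ε (1 / 2) := lt_min hεpos (by norm_num)
    have hε'1 : min ε (1 / 2) < 1 := lt_of_le_of_lt (min_le_right _ _) (by norm_num)
    -- the minimal torus size at which the `min ε ½`-criterion holds at coupling `β = k`
    let S₀ : ℕ → ℕ := fun k =>
      if h : ∃ S : ℕ, 2 ≤ S ∧ ∀ z ∈ Subgroup.center G, ∀ q,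
          1 - Z (k : ℝ) S z q / Z (k : ℝ) S 1 q ≤ min ε (1 / 2) then Nat.find h else 0
    have hex : ∀ᶠ k : ℕ in atTop, ∃ S : ℕ, 2 ≤ S ∧ ∀ z ∈ Subgroup.center G, ∀ q,
        1 - Z (k : ℝ) S z q / Z (k : ℝ) S 1 q ≤ min ε (1 / 2) := by
      have h1 : ∀ᶠ k : ℕ in atTop, ∀ z ∈ Subgroup.center G, ∀ q,
          1 - Z (k : ℝ) (S₁ (k : ℝ)) z q / Z (k : ℝ) (S₁ (k : ℝ)) 1 q ≤ min ε (1 / 2) :=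
        tendsto_natCast_atTop_atTop.eventually (hε _ hε')
      have h2 : ∀ᶠ k : ℕ in atTop, 2 ≤ S₁ (k : ℝ) :=
        (hS₁.comp tendsto_natCast_atTop_atTop).eventually_ge_atTop 2
      filter_upwards [h1, h2] with k hk hk2
      exact ⟨S₁ (k : ℝ), hk2, hk⟩
    have hspec : ∀ k : ℕ, (∃ S : ℕ, 2 ≤ S ∧ ∀ z ∈ Subgroup.center G, ∀ q,
        1 - Z (k : ℝ) S z q / Z (k : ℝ) S 1 q ≤ min ε (1 / 2)) →
        2 ≤ S₀ k ∧ ∀ z ∈ Subgroup.center G, ∀ q,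
          1 - Z (k : ℝ) (S₀ k) z q / Z (k : ℝ) (S₀ k) 1 q ≤ min ε (1 / 2) := by
      intro k hk
      have hS₀k : S₀ k = Nat.find hk := dif_pos hk
      rw [hS₀k]
      exact Nat.find_spec hk
    have hmin : ∀ k : ℕ, ∀ hk : (∃ S : ℕ, 2 ≤ S ∧ ∀ z ∈ Subgroup.center G, ∀ q,
        1 - Z (k : ℝ) S z q / Z (k : ℝ) S 1 q ≤ min ε (1 / 2)), ∀ S : ℕ, S < S₀ k →
        ¬ (2 ≤ S ∧ ∀ z ∈ Subgroup.center G, ∀ q,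
          1 - Z (k : ℝ) S z q / Z (k : ℝ) S 1 q ≤ min ε (1 / 2)) := by
      intro k hk S hS
      have hS₀k : S₀ k = Nat.find hk := dif_pos hk
      rw [hS₀k] at hS
      exact Nat.find_min hk hS
    -- at every fixed size the criterion eventually fails, so the minimal scale diverges
    have hS₀ : Tendsto S₀ atTop atTop := by
      refine tendsto_atTop.2 fun M => ?_
      have hfailM : ∀ᶠ k : ℕ in atTop, ∀ S ∈ Finset.Ico 2 M, ∃ z ∈ Subgroup.center G, ∃ q,
          min ε (1 / 2) < 1 - Z (k : ℝ) S z q / Z (k : ℝ) S 1 q := by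
        refine (Filter.eventually_all_finset _).2 fun S hS => ?_
        have h2S : 2 ≤ S := (Finset.mem_Ico.1 hS).1
        exact tendsto_natCast_atTop_atTop.eventually (hFail G hG hc r Z hZ S h2S _ hε'1)
      filter_upwards [hex, hfailM] with k hk hkM
      by_contra hlt
      push Not at hlt
      have hP := hspec k hk
      obtain ⟨z, hz, q, hq⟩ := hkM (S₀ k) (Finset.mem_Ico.2 ⟨hP.1, hlt⟩)
      exact absurd (hP.2 z hz q) (not_le.2 hq)
    -- eventually: the criterion holds at `S₀ k` and FAILS at the comparable size `S₀ k - 1` (pin)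
    have hpin : ∀ᶠ k : ℕ in atTop,
        (∀ z ∈ Subgroup.center G, ∀ q,
            1 - Z (k : ℝ) (S₀ k) z q / Z (k : ℝ) (S₀ k) 1 q ≤ min ε (1 / 2)) ∧
          ∃ S' : ℕ, 2 ≤ S' ∧ S₀ k ≤ 2 * S' ∧ ∃ z ∈ Subgroup.center G, ∃ q,
            min ε (1 / 2) < 1 - Z (k : ℝ) S' z q / Z (k : ℝ) S' 1 q := by
      filter_upwards [hex, hS₀.eventually_ge_atTop 3] with k hk hk3
      refine ⟨(hspec k hk).2, S₀ k - 1, by omega, by omega, ?_⟩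
      have hnot := hmin k hk (S₀ k - 1) (by omega)
      have hnot' : ¬ ∀ z ∈ Subgroup.center G, ∀ q,
          1 - Z (k : ℝ) (S₀ k - 1) z q / Z (k : ℝ) (S₀ k - 1) 1 q ≤ min ε (1 / 2) :=
        fun h => hnot ⟨by omega, h⟩
      push Not at hnot'
      exact hnot'
    -- volume-uniform clustering at rate `m / S₀ k` from the criterion at `S₀ k`
    have hclust : ∀ A B : Literature.MathematicalPhysics.QuantumFieldTheory.YMSpecies G, ∃ K : ℝ,
        ∀ᶠ k : ℕ in atTop, ∀ S : ℕ, S₀ k ≤ S → ∀ n : ℕ, n ≤ S →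
          |Literature.MathematicalPhysics.QuantumFieldTheory.latticeConnectedCorr r.ρ (k : ℝ)
              (2 * S + 1) A.F B.F n| ≤ K * Real.exp (-(m * n / S₀ k)) := by
      intro A B
      obtain ⟨K, hK⟩ := hgap A B
      refine ⟨K, ?_⟩
      filter_upwards [hex, tendsto_natCast_atTop_atTop.eventually_ge_atTop β₁] with k hk hkβ
      have hP := hspec k hk
      intro S hS n hn
      refine hK (k : ℝ) hkβ (S₀ k) hP.1 ?_ S hS n hn
      intro S' hS' z hz q
      exact hfb (k : ℝ) (Nat.cast_nonneg k) (S₀ k) S' hP.1 hS'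
        (fun z hz q => le_trans (hP.2 z hz q) (min_le_left _ _)) z hz q
    obtain ⟨sch, T, ⟨φ, hφ, hφβ⟩, hYM, hNT, hNG, Δ, hΔ, hgapT, hlgap⟩ :=
      hLegs G hG hc r Z hZ (min ε (1 / 2)) m (fun k : ℕ => (k : ℝ)) S₀ hε' hε'1 hm
        (fun k => Nat.cast_nonneg k) tendsto_natCast_atTop_atTop hS₀ hpin hclust
    -- the scheme's couplings are the subsequence `k ↦ φ k` of `β_k = k`: weak-coupling limit
    have hW : sch.HasWeakCouplingLimit := by
      have hβ : sch.β = fun k => ((φ k : ℕ) : ℝ) := funext fun k => (hφβ k).1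
      show Tendsto sch.β atTop atTop
      rw [hβ]
      exact tendsto_natCast_atTop_atTop.comp hφ.tendsto_atTop
    exact ⟨r, sch, T, hW, hYM, hNT, hNG, Δ, hΔ, hgapT, hlgap⟩

end Summit.QuantumFields.YangMills.Theses.MarginalTwistOnset
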